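import Mathlib.NumberTheory.NumberField.AdeleRing
import Mathlib.MeasureTheory.Group.FundamentalDomain
import Mathlib.MeasureTheory.Function.LpSpace.Basic
import Mathlib.Algebra.Lie.Submodule
import Literature.NumberTheory.Automorphic.AutomorphicForms
import Literature.NumberTheory.Automorphic.AdelicGLnGlue
import Literature.NumberTheory.Automorphic.ArchimedeanGLn
import Literature.NumberTheory.Automorphic.HarishChandraGL
import Literature.NumberTheory.Automorphic.GLnCuspidalSpectrum
import Literature.NumberTheory.Automorphic.GLnAdelicStructure
import Literature.NumberTheory.Automorphic.SatakeParametersGL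
import Literature.NumberTheory.Automorphic.HeckeAlgebra
import Literature.NumberTheory.Automorphic.AutomorphicSpectrum
import Literature.NumberTheory.Automorphic.HilbertRepSpectrum
import Literature.NumberTheory.Automorphic.InfinityType
import Literature.NumberTheory.GaloisRepresentations.IntegralGaloisAction
import HarnessLib

-- provenance: harness21/H21/H21/Prelude/AutomorphicL/AutomorphicRepsGL.lean @ f48e526 (interim HEAD d8f2665); M5 mechanical rewrite
/-!
# Cuspidal automorphic representations of `GL_n(𝔸_K)`: cusp forms, Satake data, infinity types

Trunk: AutomorphicL (prelude, item I15 `AutomorphicRepsGL`; notions `automorphic_form`,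
`automorphic_representation`, `algebraic_infinity_type`; design D2, D3; reviews 2, 4, 17).

Let `K` be a number field and `GL_n / K`. On top of the honest automorphy datum
`AutomorphyDatum.gl n K` (accepted `AdelicGLnGlue`) and the general notions
`IsAutomorphicForm`, `AutomorphicRepData` (accepted `AutomorphicForms`, Borel–Jacquet 1979 §4)
this file provides, for `GL_n` specifically:

* **Cusp forms (D2 (i)).** `CuspConditionGL n K φ k`: the constant term of `φ : GL_n(𝔸_K) → ℂ`
  along the standard maximal parabolic `P_k` vanishes — the accepted G19 shape
  `ConstantTermVanishes` (integral over a fundamental domain of `𝔫_k(K)` in `𝔫_k(𝔸_K)` for an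
  additive Haar measure, reusing G19's `blockNilpotent`, `rationalBlock`, `glUnipotent` and its
  Borel structure on `𝔫_k(𝔸_K)`) but with the unipotent variable on the **left**, since
  Borel–Jacquet forms are *left*-`G(K)`-invariant (mirror convention, review 2); the real closure
  lemmas `CuspConditionGL.zero/add/smul`; the bridge `cuspConditionGL_invQuot_iff` through the
  inversion dictionary `invQuot`; `IsCuspFormGL`, the span `cuspFormsGL`, and cuspidal automorphic
  representations `CuspidalAutomorphicRepData n K` (Borel–Jacquet 1979, 4.4–4.6).
* **Local (unramified) data, adelically (as in G19).** `AutomorphicRepData.HasSatakeParamAt π v α`: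
  `π = W / W'` has Satake parameter `α` (a multiset of `n` complex numbers) at the finite place `v`
  — there is a form `φ ∈ W ∖ W'` fixed by a principal congruence subgroup `K(𝔫)` with `v ∤ 𝔫 ≠ 0`
  which is an eigenvector *modulo `W'`* of G19's Hecke operators
  `heckeOperator (rightTranslation _) K(𝔫) t_{v,i}` (`t_{v,i} = heckeDiagAt n K v ϖ i`) with the
  Satake–Tamagawa eigenvalues `q_v^{i(n-i)/2} e_i(α)`, verbatim G19's normalisation
  (`HasSatakeParameterAt` of `GLnAdelicStructure`); `IsUnramifiedAt`, `HasHeckePolynomialAt`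
  (the Harris–Lan–Taylor–Thorne / Clozel Hecke polynomial `∏ (X - q_v^{(n-1)/2} α_j)`, equal to
  G19's `heckePolynomial` of the eigenvalues by `heckePolynomial_eq_satakePolynomial`),
  `IsNearlyEquivalent`. No local representation of `GL_n(K_v)` is extracted (that would need
  local-field instances on `v.adicCompletion K`, absent from the pin).
* **Archimedean data (D3, review 4).** `AutomorphicRepData.HasArchParameter π χ` transports the
  (unique) Lie algebra action of `π` on `W / W'` along Mathlib's `LieSubalgebra.topEquiv`
  (`𝔤 = ⊤ ≤ 𝔤𝔩_n(K_∞)` for the `GL_n` datum) to the accepted place-by-place predicate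
  `HasArchParameter` of `ArchimedeanGLn`; algebraicity is expressed with **G19's**
  `InfinityType K n`: `HasInfinityType`, `IsRegularAlgebraic`, `IsLAlgebraic`, `IsCAlgebraic`,
  `HasWeightZero` (Clozel 1990, §1.2, §3.3–3.5; Buzzard–Gee 2014, §3.1). No parallel multiset
  predicates are defined.
* **Bridges to G19's `L²` objects (D2 (ii)).** `IsAssociatedL2 π Π` relates a cuspidal
  automorphic representation datum `π = W / W'` to a G19 `CuspidalAutomorphicRepGL n K μ`
  (an irreducible closed subspace `Π ≤ L²_cusp(GL_n(𝔸_K) ⧸ A_G GL_n(K))`): `W = W' ⊕ V_Π` where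
  `V_Π` is spanned by the automorphic forms `invQuot f`, `[f] ∈ Π`. Named facts (known in print,
  D-0014): `cuspConditionGL_invQuot_iff`, `cuspidal_W'_eq_bot`, `exists_isAssociatedL2`,
  `exists_cuspidalRepData_of_L2`, `hasSatakeParamAt_iff_L2`, `hasSatakeParamAt_unique`,
  `exists_hasInfinityType`, `hasSatakeParamAt_cofinite`, `harishChandra_finiteness_gl`.

## Design notes

* (H1) `attribute [local instance 100] LieRing.ofAssociativeRing`; (H5) `open scoped Classical`;
  no normed matrix instance and no `ContDiff` statement occur in this file (H3, H4 are inherited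
  through `IsAutomorphicForm`).
* Typing rule (Probe5): forms `φ`, group elements `g` and the spaces `W` are typed on
  `(AdelicGroupData.gl n K).Adelic` (not the unfolded `GL (Fin n) 𝔸_K`) so that the `Group` and
  `Pi` instances are found as in G19; level subgroups of `GL (Fin n) 𝔸_K` unify as arguments.
* `A_G`-invariance. Functions on G19's quotient `GL_n(𝔸_K) ⧸ A_G GL_n(K)` are `A_G`-invariant,
  Borel–Jacquet forms are not; hence `exists_isAssociatedL2` assumes that the forms of `π` are
  invariant under `A_G = (AdelicGroupData.gl n K).center'` (every cuspidal representation is a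
  twist by `|det|^s` of such a one; Borel–Jacquet 1979, 4.4 and 5.7).
* `cuspidal_W'_eq_bot`. The literal statement "`W' = ⊥` for cuspidal `π`" is false as a property
  of the *datum* (`W = π₁ ⊕ π₂`, `W' = π₁`); what is true (semisimplicity of the space of cusp
  forms, Gelfand–Piatetski-Shapiro) is that a cuspidal `W / W'` is realised on a stable complement
  `W₀` of `W'` in `W`, i.e. by a cuspidal datum with `W₀' = ⊥`; this is the statement made.
* `harishChandra_finiteness_gl` fixes the `K_∞`-types through a finite-dimensional right
  `K_∞`-stable space `M` of functions on `K_∞` containing all slices `k ↦ φ (g k)` (equivalent to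
  fixing a finite set of `K_∞`-types: take `M` = matrix coefficients), and the ideal of `Z(𝔤)`
  through a character `θ` (`HasZCharacter`, ideal `ker θ` of codimension one), the case to which
  Harish-Chandra's theorem reduces.
* Predicates vs named facts. `IsRegularAlgebraic`, `IsLAlgebraic`, `IsCAlgebraic` and `HasWeightZero`
  are *definitions* — predicates on `π` (Clozel 1990, Déf. 1.8, 3.12; Buzzard–Gee 2014, Def. 2.3.1,
  3.1.1, 3.1.2), written with an explicit binder `(π : …)`; they are not named facts and have no
  `_holds` discharge: `∀ π, π.IsLAlgebraic` is false (the trivial representation of `GL_2(𝔸_ℚ)` is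
  C-algebraic and not L-algebraic, `|det|^{1/2}` is L-algebraic and not C-algebraic; Buzzard–Gee
  2014, §3.1). The named facts of the `AutomorphicRepData` namespace are `hasSatakeParamAt_unique`,
  `hasSatakeParamAt_cofinite` and `exists_hasInfinityType` (each asserted for every `π`).
* `ℕ`-subtraction `n - 1`, `n - i` in the Satake normalisation is G19's (exact for `i ≤ n`,
  `1 ≤ n`; for `n = 0` every predicate is about the trivial group).
* Mathlib (grepped): `MeasureTheory.IsAddFundamentalDomain`, `Measure.IsAddHaarMeasure`,
  `MeasureTheory.MemLp`, `MemLp.toLp`, `LieSubalgebra.topEquiv`, `Multiset.esymm`, `Valued.v`,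
  `WithZero.exp`, `Filter.cofinite`, `Submodule.span`. Mathlib has classical modular/cusp forms on
  `ℍ` for subgroups of `SL₂(ℤ)` (`NumberTheory/ModularForms`) and abstract Hecke rings
  (`NumberTheory/HeckeRing`), but no adelic automorphic forms, automorphic representations,
  Satake parameters or infinity types.

## M5 migration note

`AutomorphyDatum.gl n K hcpt` takes the named fact `hcpt : isCompact_glFiniteIntegralLevel n K`
(`GLnAdelicStructure`, see the downstream note of `AdelicGLnGlue`) as an explicit parameter, so
every declaration whose type mentions the datum threads `hcpt`: explicitly in `IsCuspFormGL n K
hcpt`, `cuspFormsGL n K hcpt`, `CuspidalAutomorphicRepData n K hcpt`, `formsOfL2 hcpt μ`, and the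
named facts `cuspidal_W'_eq_bot`, `exists_isAssociatedL2`, `exists_cuspidalRepData_of_L2`,
`hasSatakeParamAt_iff_L2`, `harishChandra_finiteness_gl`; implicitly (`{hcpt}`, read off the type
of `π`) in the `AutomorphicRepData` namespace and in `IsAssociatedL2`, `isUnramifiedAt_iff_L2`.
The formerly sorried theorems are named facts `def … : Prop` (D-0014); `isUnramifiedAt_iff_L2`
takes the fact `hasSatakeParamAt_iff_L2 hcpt μ` as a hypothesis.

## References

* A. Borel, H. Jacquet, *Automorphic forms and automorphic representations*, Proc. Sympos. Pure
  Math. 33 (Corvallis 1979), part 1, §4.4–4.6, §5.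
* L. Clozel, *Motifs et formes automorphes: applications du principe de fonctorialité*, in
  Automorphic forms, Shimura varieties, and L-functions I (1990), §1.1–1.3, §3.1–3.5.
* D. Bump, *Automorphic Forms and Representations* (1997), §3.3–3.4.
* D. Flath, *Decomposition of representations into tensor products*, Corvallis 1979, Thm. 3.
* Harish-Chandra, *Automorphic forms on semisimple Lie groups*, LNM 62 (1968), Thm. 1.
* K. Buzzard, T. Gee, *The conjectural connections between automorphic representations and
  Galois representations* (2014), §3.1.
-/

-- Mathlib idiom (Mathlib/Algebra/Lie/OfAssociative.lean); needed to mention Lie subalgebras of matrix algebras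
attribute [local instance 100] LieRing.ofAssociativeRing

open scoped MatrixGroups Matrix ContDiff Classical Polynomial
open NumberField NumberField.mixedEmbedding IsDedekindDomain MeasureTheory

noncomputable section

namespace Literature.NumberTheory.Automorphic

variable (n : ℕ) (K : Type) [Field K] [NumberField K]

/-! ## Cusp forms on `GL_n(𝔸_K)` (Borel–Jacquet 4.4) -/

section CuspForms

/-- The **constant term** of `φ : GL_n(𝔸_K) → ℂ` along the standard maximal parabolic `P_k`
**vanishes**: for every additive Haar measure `ν` on `𝔫_k(𝔸_K) ≅ N_k(𝔸_K)`, every measurable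
fundamental domain `𝓕` of the translation action of `𝔫_k(K)` (so `𝓕 ≃ N_k(K) \ N_k(𝔸_K)`) and
every `g ∈ GL_n(𝔸_K)`, `X ↦ φ ((1 + X) g)` is integrable on `𝓕` and
`∫_𝓕 φ ((1 + X) g) dν(X) = 0`, i.e. `∫_{N_k(K) \ N_k(𝔸_K)} φ (u g) du = 0`. This is G19's
`ConstantTermVanishes` with the unipotent variable on the *left*, as befits left
`G(K)`-invariant functions (D2 (i); the two are exchanged by `invQuot`,
`cuspConditionGL_invQuot_iff`). Borel–Jacquet 1979, 4.4; Godement–Jacquet, LNM 260, §10. [cite: BorelJacquet1979, 4.4] -/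
def CuspConditionGL (φ : (AdelicGroupData.gl n K).Adelic → ℂ) (k : ℕ) : Prop :=
  ∀ (ν : Measure (blockNilpotent n k (AdeleRing (𝓞 K) K))) [ν.IsAddHaarMeasure]
    (𝓕 : Set (blockNilpotent n k (AdeleRing (𝓞 K) K))),
    IsAddFundamentalDomain (rationalBlock n k K) 𝓕 ν →
      ∀ g : (AdelicGroupData.gl n K).Adelic,
        IntegrableOn (fun X ↦ φ (glUnipotent n k K (Multiplicative.ofAdd X) * g)) 𝓕 ν ∧
          ∫ X in 𝓕, φ (glUnipotent n k K (Multiplicative.ofAdd X) * g) ∂ν = 0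

variable {n K}

/-- The zero function satisfies the cusp condition. Borel–Jacquet 1979, 4.4. [cite: BorelJacquet1979, 4.4] -/
theorem CuspConditionGL.zero (k : ℕ) :
    CuspConditionGL n K (0 : (AdelicGroupData.gl n K).Adelic → ℂ) k := by
  intro ν _ 𝓕 _ g
  exact ⟨integrableOn_zero, by simp⟩

/-- The cusp condition is preserved under sums (`integral_add`, using the integrability
clause). Borel–Jacquet 1979, 4.4. [cite: BorelJacquet1979, 4.4] -/
theorem CuspConditionGL.add {φ ψ : (AdelicGroupData.gl n K).Adelic → ℂ} {k : ℕ}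
    (hφ : CuspConditionGL n K φ k) (hψ : CuspConditionGL n K ψ k) :
    CuspConditionGL n K (φ + ψ) k := by
  intro ν _ 𝓕 h𝓕 g
  obtain ⟨hφi, hφ0⟩ := hφ ν 𝓕 h𝓕 g
  obtain ⟨hψi, hψ0⟩ := hψ ν 𝓕 h𝓕 g
  refine ⟨hφi.add hψi, ?_⟩
  change ∫ X in 𝓕, φ _ + ψ _ ∂ν = 0
  rw [integral_add hφi hψi, hφ0, hψ0, add_zero]

/-- The cusp condition is preserved under scalar multiplication (`integral_smul`).
Borel–Jacquet 1979, 4.4. [cite: BorelJacquet1979, 4.4] -/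
theorem CuspConditionGL.smul {φ : (AdelicGroupData.gl n K).Adelic → ℂ} {k : ℕ} (c : ℂ)
    (hφ : CuspConditionGL n K φ k) : CuspConditionGL n K (c • φ) k := by
  intro ν _ 𝓕 h𝓕 g
  obtain ⟨hφi, hφ0⟩ := hφ ν 𝓕 h𝓕 g
  refine ⟨hφi.smul c, ?_⟩
  change ∫ X in 𝓕, c • φ _ ∂ν = 0
  rw [integral_smul, hφ0, smul_zero]

/-- The cusp condition is invariant under right translation: replace `g` by `g h`.
Borel–Jacquet 1979, 4.4. [cite: BorelJacquet1979, 4.4] -/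
theorem CuspConditionGL.rightTranslation {φ : (AdelicGroupData.gl n K).Adelic → ℂ} {k : ℕ}
    (hφ : CuspConditionGL n K φ k) (h : (AdelicGroupData.gl n K).Adelic) :
    CuspConditionGL n K (rightTranslation (AdelicGroupData.gl n K) h φ) k := by
  intro ν _ 𝓕 h𝓕 g
  simpa only [rightTranslation_apply, mul_assoc] using hφ ν 𝓕 h𝓕 (g * h)

variable (n K)

/-- **The inversion bridge for cuspidality** (D2): for `f` on G19's quotient
`GL_n(𝔸_K) ⧸ A_G GL_n(K)`, the left-invariant function `invQuot f : g ↦ f [g⁻¹]` satisfies the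
(left) cusp condition iff `f` has vanishing constant terms in G19's (right) sense
`ConstantTermVanishes`. (`(1 + X)⁻¹ = 1 - X` on `𝔫_k`, and `X ↦ -X` preserves additive Haar
measures and maps fundamental domains of `𝔫_k(K)` to fundamental domains.)
Borel–Jacquet 1979, 4.4. [cite: BorelJacquet1979, 4.4] -/
def AutomorphicRepsGL.cuspConditionGL_invQuot_iff : Prop :=
  ∀ (f : (AdelicGroupData.gl n K).automorphicQuotient → ℂ) (k : ℕ),
    CuspConditionGL n K (invQuot (AdelicGroupData.gl n K) f) k ↔ ConstantTermVanishes n K f k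

variable (hcpt : isCompact_glFiniteIntegralLevel n K)

/-- `φ : GL_n(𝔸_K) → ℂ` is a **cusp form** on `GL_n` over `K`: an automorphic form for the datum
`AutomorphyDatum.gl n K hcpt` all of whose constant terms along the standard maximal parabolics
`P_k`, `0 < k < n`, vanish (equivalently along all proper standard parabolics).
Borel–Jacquet 1979, 4.4; for `n = 1` the parabolic condition is empty. [cite: BorelJacquet1979, 4.4] -/
def IsCuspFormGL (φ : (AdelicGroupData.gl n K).Adelic → ℂ) : Prop :=
  IsAutomorphicForm (AutomorphyDatum.gl n K hcpt) φ ∧ ∀ k, 0 < k → k < n → CuspConditionGL n K φ k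

/-- The space `𝒜₀(GL_n(K) \ GL_n(𝔸_K))` of cusp forms, as the complex span of the cusp forms.
Borel–Jacquet 1979, 4.4–4.6. [cite: BorelJacquet1979, 4.4–4.6] -/
def cuspFormsGL : Submodule ℂ ((AdelicGroupData.gl n K).Adelic → ℂ) :=
  Submodule.span ℂ {φ | IsCuspFormGL n K hcpt φ}

variable {n K hcpt}

/-- A cusp form lies in the space of cusp forms. Borel–Jacquet 1979, 4.4. [cite: BorelJacquet1979, 4.4] -/
theorem IsCuspFormGL.mem_cuspFormsGL {φ : (AdelicGroupData.gl n K).Adelic → ℂ}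
    (hφ : IsCuspFormGL n K hcpt φ) : φ ∈ cuspFormsGL n K hcpt :=
  Submodule.subset_span hφ

variable (n K hcpt) in
/-- Cusp forms are automorphic forms: `𝒜₀ ≤ 𝒜`. Borel–Jacquet 1979, 4.4. [cite: BorelJacquet1979, 4.4] -/
theorem cuspFormsGL_le_automorphicForms :
    cuspFormsGL n K hcpt ≤ automorphicForms (AutomorphyDatum.gl n K hcpt) :=
  Submodule.span_mono fun _ hφ ↦ hφ.1

/-- Every element of the space of cusp forms satisfies the cusp conditions (these are linear,
`CuspConditionGL.zero/add/smul`). Borel–Jacquet 1979, 4.4. [cite: BorelJacquet1979, 4.4] -/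
theorem cuspConditionGL_of_mem_cuspFormsGL {φ : (AdelicGroupData.gl n K).Adelic → ℂ}
    (hφ : φ ∈ cuspFormsGL n K hcpt) {k : ℕ} (hk : 0 < k) (hkn : k < n) :
    CuspConditionGL n K φ k := by
  induction hφ using Submodule.span_induction with
  | mem _ h => exact h.2 k hk hkn
  | zero => exact CuspConditionGL.zero k
  | add _ _ _ _ h₁ h₂ => exact h₁.add h₂
  | smul c _ _ h => exact h.smul c

variable (n K hcpt) in
/-- A **cuspidal automorphic representation** of `GL_n(𝔸_K)` as a datum: an automorphic
representation `π = W / W'` for `AutomorphyDatum.gl n K hcpt` (accepted `AutomorphicRepData`)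
realised on cusp forms, `W ≤ 𝒜₀`. Borel–Jacquet 1979, 4.6; Clozel 1990, §1.1. [cite: BorelJacquet1979, 4.6] -/
def CuspidalAutomorphicRepData : Type _ :=
  {π : AutomorphicRepData (AutomorphyDatum.gl n K hcpt) // π.W ≤ cuspFormsGL n K hcpt}

/-- The forms of a cuspidal automorphic representation are cusp forms.
Borel–Jacquet 1979, 4.6. [cite: BorelJacquet1979, 4.6] -/
theorem CuspidalAutomorphicRepData.le_cuspFormsGL (π : CuspidalAutomorphicRepData n K hcpt) :
    π.1.W ≤ cuspFormsGL n K hcpt :=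
  π.2

/-- **Cuspidal representations are subrepresentations** (semisimplicity of the space of cusp
forms, Gelfand–Piatetski-Shapiro; Borel–Jacquet 1979, 4.6): a cuspidal `π = W / W'` is realised
on a stable complement `W₀` of `W'` in `W` (`W₀ ⊓ W' = ⊥`, `W₀ ⊔ W' = W`), i.e. by a cuspidal
datum `π₀ = W₀ / ⊥`. (The literal "`W' = ⊥`" is a property of the chosen datum, not of `π`, and
fails for `W = π₁ ⊕ π₂ ⊇ W' = π₁`; see the module docstring.) [cite: BorelJacquet1979, 4.6] -/
def cuspidal_W'_eq_bot (hcpt : isCompact_glFiniteIntegralLevel n K) : Prop :=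
  ∀ π : CuspidalAutomorphicRepData n K hcpt,
    ∃ π₀ : CuspidalAutomorphicRepData n K hcpt,
      π₀.1.W' = ⊥ ∧ π₀.1.W ⊓ π.1.W' = ⊥ ∧ π₀.1.W ⊔ π.1.W' = π.1.W

end CuspForms

/-! ## Local unramified data of an automorphic representation (adelic Satake parameters) -/

namespace AutomorphicRepData

variable {n K} {hcpt : isCompact_glFiniteIntegralLevel n K}
  (π : AutomorphicRepData (AutomorphyDatum.gl n K hcpt))

/-- `π = W / W'` **has Satake parameter `α` at the finite place `v`** (a multiset of `n` complex
numbers): for some non-zero level `𝔫 ⊆ 𝓞 K` prime to `v` (so that `K(𝔫)` is `GL_n(𝒪_v)` at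
`v`) and some uniformizer `ϖ` of `K_v` (`|ϖ|_v = exp (-1)`), there is a `K(𝔫)`-fixed form
`φ ∈ W ∖ W'` which is a Hecke eigenvector *modulo `W'`* of the double-coset operators
`[K(𝔫) t_{v,i} K(𝔫)]` (G19 `heckeOperator` for `rightTranslation`, `t_{v,i} = heckeDiagAt n K v ϖ i
= diag(ϖ, …, ϖ, 1, …, 1)`), `0 ≤ i ≤ n`, with eigenvalues `q_v^{i(n-i)/2} e_i(α)`
(`q_v = v.residueCard`, `e_i = Multiset.esymm`); i.e. the class of `φ` spans the spherical line
of `π_v` and `α` is the Satake parameter of the unramified representation `π_v`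
(Satake; Tamagawa 1963; Bump §3.3; Borel–Jacquet 1979, 4.6; verbatim G19's normalisation of
`HasSatakeParameterAt`). [cite: Tamagawa1963] -/
def HasSatakeParamAt (v : HeightOneSpectrum (𝓞 K)) (α : Multiset ℂ) : Prop :=
  ∃ (𝔫 : Ideal (𝓞 K)) (ϖ : (v.adicCompletion K)ˣ), 𝔫 ≠ 0 ∧ ¬ v.asIdeal ∣ 𝔫 ∧
    Valued.v (ϖ : v.adicCompletion K) = WithZero.exp (-1 : ℤ) ∧ Multiset.card α = n ∧
      ∃ φ ∈ π.W, φ ∉ π.W' ∧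
        (∀ u ∈ principalCongruenceLevel n K 𝔫,
          rightTranslation (AdelicGroupData.gl n K) u φ = φ) ∧
        ∀ i ≤ n, heckeOperator (rightTranslation (AdelicGroupData.gl n K))
              (principalCongruenceLevel n K 𝔫) (heckeDiagAt n K v ϖ i) φ -
            ((((Real.sqrt (v.residueCard : ℝ)) : ℝ) : ℂ) ^ (i * (n - i)) * α.esymm i) • φ ∈ π.W'

/-- A Satake parameter has `n` entries (definitional). Bump §3.3. [folklore] -/
theorem HasSatakeParamAt.card_eq {π : AutomorphicRepData (AutomorphyDatum.gl n K hcpt)}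
    {v : HeightOneSpectrum (𝓞 K)} {α : Multiset ℂ} (h : π.HasSatakeParamAt v α) :
    Multiset.card α = n := by
  obtain ⟨_, _, _, _, _, hα, _⟩ := h
  exact hα

/-- `π` is **unramified at `v`**: it has a Satake parameter there (i.e. `π_v` has a non-zero
`GL_n(𝒪_v)`-fixed vector). Borel–Jacquet 1979, 4.6; Bump §3.3–3.4. [cite: BorelJacquet1979, 4.6] -/
def IsUnramifiedAt (v : HeightOneSpectrum (𝓞 K)) : Prop :=
  ∃ α : Multiset ℂ, π.HasSatakeParamAt v α

/-- `π` **has Hecke polynomial `P` at `v`**: `P = ∏_j (X - q_v^{(n-1)/2} α_j)` for a Satake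
parameter `α` of `π` at `v` — the polynomial whose roots are the Frobenius eigenvalues of the
Galois representation expected to correspond to `π` (Clozel 1990, §3.3 and Conj. 4.5;
Harris–Lan–Taylor–Thorne 2016, Introduction). By Tamagawa's identity
(`heckePolynomial_eq_satakePolynomial` of G19) it is `∑ (-1)^i q_v^{i(i-1)/2} t_{v,i} X^{n-i}`
in terms of the Hecke eigenvalues `t_{v,i}`. [cite: Clozel1990, §3.3 and Conj. 4.5] -/
def HasHeckePolynomialAt (v : HeightOneSpectrum (𝓞 K)) (P : ℂ[X]) : Prop :=
  ∃ α : Multiset ℂ, π.HasSatakeParamAt v α ∧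
    P = satakePolynomial (α.map fun a ↦ ((((Real.sqrt (v.residueCard : ℝ)) : ℝ) : ℂ) ^ (n - 1) * a))

/-- Two automorphic representations of `GL_n(𝔸_K)` are **nearly equivalent**: at all but
finitely many finite places both are unramified with the same Satake parameter (i.e.
`π_v ≅ π'_v` for almost all `v`). Jacquet–Shalika 1981, §4; Clozel 1990, §1.1. [cite: JacquetShalika1981, §4] -/
def IsNearlyEquivalent (π π' : AutomorphicRepData (AutomorphyDatum.gl n K hcpt)) : Prop :=
  ∀ᶠ v in Filter.cofinite, ∃ α : Multiset ℂ, π.HasSatakeParamAt v α ∧ π'.HasSatakeParamAt v α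

/-- **Uniqueness of Satake parameters.** The Satake parameter of `π` at `v` (as a multiset) does
not depend on the auxiliary level, uniformizer or eigenform: `W / W' ≅ π_∞ ⊗ ⊗'_v π_v` with `π_v`
irreducible admissible, the unramified Hecke algebra at `v` acts on `π_v^{GL_n(𝒪_v)}` (a line) by
a character, and `e_0(α), …, e_n(α)` determine `α` when `card α = n`.
Flath 1979, Thm. 3; Borel–Jacquet 1979, 4.6; Bump §3.3. [cite: Flath1979, Thm. 3] -/
def hasSatakeParamAt_unique : Prop :=
  ∀ {v : HeightOneSpectrum (𝓞 K)} {α β : Multiset ℂ},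
    π.HasSatakeParamAt v α → π.HasSatakeParamAt v β → α = β

/-- **Automorphic representations are unramified almost everywhere**: `π` has a Satake
parameter at all but finitely many finite places (a form `φ ∈ W ∖ W'` is fixed by a compact open
subgroup of `GL_n(𝔸_f)`, which contains a level `K(𝔫)`, maximal at all `v ∤ 𝔫`; `W / W'` is
admissible (BJ 4.5) and factorisable, `π_f ≅ ⊗'_v π_v` with `π_v` unramified for `v ∤ 𝔫`;
Flath 1979, Thm. 3; Borel–Jacquet 1979, 4.6). [cite: Flath1979, Thm. 3] -/
def hasSatakeParamAt_cofinite : Prop :=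
  ∀ᶠ v in Filter.cofinite, π.IsUnramifiedAt v

/-! ## Archimedean data: parameters at infinity and algebraicity (Clozel) -/

/-- `π = W / W'` **has archimedean parameter** `χ : (K →+* ℂ) → Multiset ℂ`: the Lie algebra
action `ρ𝔤` of `𝔤 = 𝔤𝔩_n(K_∞)` on `W / W'` (which exists and is unique, `exists_hasLieAction`,
`hasLieAction_unique`; here `𝔤 = ⊤ ≤ 𝔤𝔩_n(mixedSpace K)`, transported to `𝔤𝔩_n(mixedSpace K)`
along Mathlib's `LieSubalgebra.topEquiv`) has archimedean parameter `χ` place by place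
(accepted `HasArchParameter` of `ArchimedeanGLn`: Harish-Chandra parameter `χ σ_w` at a real
place `w`, `(χ σ_w, χ σ̄_w)` at a complex place). Clozel 1990, §3.3; Buzzard–Gee 2014, §3.1. [cite: Clozel1990, §3.3] -/
def HasArchParameter (χ : (K →+* ℂ) → Multiset ℂ) : Prop :=
  ∃ ρ𝔤 : (AutomorphyDatum.gl n K hcpt).arch.lie →ₗ⁅ℝ⁆ Module.End ℂ π.Quot, π.HasLieAction ρ𝔤 ∧
    Literature.NumberTheory.Automorphic.HasArchParameter
      (ρ𝔤.comp (LieSubalgebra.topEquiv :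
        (⊤ : LieSubalgebra ℝ (Matrix (Fin n) (Fin n) (mixedSpace K))) ≃ₗ⁅ℝ⁆
          Matrix (Fin n) (Fin n) (mixedSpace K)).symm.toLieHom) χ

/-- `π` **has infinity type** `T : InfinityType K n` (G19): `T` is well formed and the multisets
`{a_i}` of `z`-exponents of `T σ = {(a_i, b_i)}` are the archimedean parameter of `π`. The
infinitesimal character of `π_∞` determines the multisets `{a_i}` at `σ` and `{b_i} = {a_i at σ̄}`
but not the pairing, so `T` is not unique; the algebraicity predicates below only read the
multisets (D3). Clozel 1990, §3.3 ("type à l'infini"); Buzzard–Gee 2014, §3.1. [cite: Clozel1990, §3.3 ("type à l'infini"] -/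
def HasInfinityType (T : InfinityType K n) : Prop :=
  T.IsWellFormed ∧ π.HasArchParameter fun σ ↦ (T σ).map ArchWeight.a

/-- `π` is **regular algebraic** (Clozel): it has a C-algebraic (`a, b ∈ (n-1)/2 + ℤ`) and regular
(pairwise distinct `a`'s at each `σ`) infinity type. Clozel 1990, Déf. 1.8 and Déf. 3.12;
Harris–Lan–Taylor–Thorne 2016, Introduction. [cite: Clozel1990, Déf. 1.8 and Déf. 3.12] -/
def IsRegularAlgebraic (π : AutomorphicRepData (AutomorphyDatum.gl n K hcpt)) : Prop :=
  ∃ T : InfinityType K n, π.HasInfinityType T ∧ T.IsRegularAlgebraic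

/-- `π` is **L-algebraic**: it has an infinity type with integral exponents.
Buzzard–Gee 2014, Def. 3.1.1. [cite: BuzzardGee2014, Def. 3.1.1] -/
def IsLAlgebraic (π : AutomorphicRepData (AutomorphyDatum.gl n K hcpt)) : Prop :=
  ∃ T : InfinityType K n, π.HasInfinityType T ∧ T.IsLAlgebraic

/-- `π` is **C-algebraic** (Clozel's "algébrique"): it has an infinity type with exponents in
`(n-1)/2 + ℤ`. Clozel 1990, Déf. 1.8; Buzzard–Gee 2014, Def. 3.1.1. [cite: Clozel1990, Déf. 1.8] -/
def IsCAlgebraic (π : AutomorphicRepData (AutomorphyDatum.gl n K hcpt)) : Prop :=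
  ∃ T : InfinityType K n, π.HasInfinityType T ∧ T.IsCAlgebraic

variable (n K) in
/-- `π` **has weight zero**: its infinity type is the weight-zero type `σ ↦ {(ρ_i, -ρ_i)}_i`
(`weightZeroInfinityType`, accepted `ArchimedeanGLn`), i.e. `π_∞` has the infinitesimal character
of the trivial representation — `π` is cohomological for the trivial coefficient system.
Clozel 1990, §3.5 and Lemme 3.14; Harris–Lan–Taylor–Thorne 2016, Introduction. [cite: Clozel1990, §3.5 and Lemme 3.14] -/
def HasWeightZero (π : AutomorphicRepData (AutomorphyDatum.gl n K hcpt)) : Prop :=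
  π.HasInfinityType (weightZeroInfinityType n K)

/-- A representation of weight zero is regular algebraic
(`isRegularAlgebraic_weightZeroInfinityType`). Clozel 1990, Lemme 3.14. [cite: Clozel1990, Lemme 3.14] -/
theorem HasWeightZero.isRegularAlgebraic {π : AutomorphicRepData (AutomorphyDatum.gl n K hcpt)}
    (h : π.HasWeightZero) : π.IsRegularAlgebraic :=
  ⟨_, h, isRegularAlgebraic_weightZeroInfinityType n K⟩

/-- A regular algebraic representation is C-algebraic. Clozel 1990, Déf. 1.8, 3.12. [cite: Clozel1990, Déf. 1.8  3.12] -/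
theorem IsRegularAlgebraic.isCAlgebraic {π : AutomorphicRepData (AutomorphyDatum.gl n K hcpt)}
    (h : π.IsRegularAlgebraic) : π.IsCAlgebraic := by
  obtain ⟨T, hT, hT'⟩ := h
  exact ⟨T, hT, hT'.1⟩

/-- **Existence of an infinity type.** Every automorphic representation `π` of `GL_n(𝔸_K)` has a
(well-formed) infinity type: `π_∞ = ⊗_w π_w` with `π_w` irreducible admissible, hence with an
infinitesimal character, whose Harish-Chandra parameter at `σ` is the multiset of `z`-exponents of
the Langlands parameter of `π_w` restricted to `ℂˣ`, `z ↦ z^{a_i} z̄^{b_i}` with `a_i - b_i ∈ ℤ`.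
Clozel 1990, §3.3; Knapp, Thm. 5.44; Borel–Jacquet 1979, 4.6. [cite: Clozel1990, §3.3] -/
def exists_hasInfinityType : Prop :=
  ∃ T : InfinityType K n, π.HasInfinityType T

end AutomorphicRepData

/-! ## Bridges to G19's `L²` cuspidal spectrum through the inversion dictionary (D2 (ii)) -/

section Bridges

variable {n K} {hcpt : isCompact_glFiniteIntegralLevel n K}
  {μ : Measure (AdelicGroupData.gl n K).automorphicQuotient}
  [SMulInvariantMeasure (AdelicGroupData.gl n K).Adelic
    (AdelicGroupData.gl n K).automorphicQuotient μ]

variable (hcpt μ) in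
/-- The space `V_Π` of automorphic forms attached to a closed subspace `Π ≤ L²(GL_n(𝔸_K) ⧸ A_G
GL_n(K), μ)`: the span of the automorphic forms of the shape `invQuot f = (g ↦ f [g⁻¹])` with
`f ∈ ℒ²(μ)` and `[f] ∈ Π` (for irreducible cuspidal `Π` these are the smooth `K_∞`-finite vectors
of `Π`, an irreducible `(𝔤, K_∞) × GL_n(𝔸_f)`-module). Borel–Jacquet 1979, 4.6 (and 4.4: cusp
forms in `L²` that are `K_∞`- and `Z(𝔤)`-finite are automorphic forms); D2 (ii). [cite: BorelJacquet1979, 4.6 (and 4.4: cusp forms in  L²  that ar] -/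
def formsOfL2 (P : ContRepresentation.ClosedSubrep ((AdelicGroupData.gl n K).rightRegular μ)) :
    Submodule ℂ ((AdelicGroupData.gl n K).Adelic → ℂ) :=
  Submodule.span ℂ {φ | ∃ (f : (AdelicGroupData.gl n K).automorphicQuotient → ℂ) (hf : MemLp f 2 μ),
    hf.toLp f ∈ P ∧ φ = invQuot (AdelicGroupData.gl n K) f ∧
      IsAutomorphicForm (AutomorphyDatum.gl n K hcpt) φ}

/-- The cuspidal automorphic representation datum `π = W / W'` **is associated with** the G19
cuspidal `L²`-representation `Π ≤ L²_cusp(GL_n(𝔸_K) ⧸ A_G GL_n(K), μ)`: `W = W' + V_Π`, where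
`V_Π = formsOfL2 hcpt μ Π` is spanned by the automorphic forms `g ↦ f [g⁻¹]`, `[f] ∈ Π` (so that
`W / W' ≅ V_Π / (V_Π ∩ W') = V_Π`, `V_Π` being irreducible). D2 (ii); Borel–Jacquet 1979, 4.6. [cite: BorelJacquet1979, 4.6] -/
def IsAssociatedL2 (π : CuspidalAutomorphicRepData n K hcpt)
    (P : CuspidalAutomorphicRepGL n K μ) : Prop :=
  π.1.W = π.1.W' ⊔ formsOfL2 hcpt μ P.1

end Bridges

section BridgeTheorems

variable {n K} {hcpt : isCompact_glFiniteIntegralLevel n K}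
  {μ : Measure (AdelicGroupData.gl n K).automorphicQuotient}
  [(AdelicGroupData.gl n K).IsAutomorphicMeasure μ]

variable (hcpt μ) in
/-- **From `(𝔤, K_∞) × G(𝔸_f)`-modules to `L²`.** A cuspidal automorphic representation
`π = W / W'` of `GL_n(𝔸_K)` whose forms are invariant under `A_G` is associated with an
irreducible closed subspace of `L²_cusp(GL_n(𝔸_K) ⧸ A_G GL_n(K), μ)`: cusp forms are bounded
(BJ 4.4), hence square-integrable modulo `A_G GL_n(K)`; the space of cusp forms is a direct sum
of irreducible stable subspaces (Gelfand–Piatetski-Shapiro), so `W = W' ⊕ V` with `V`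
irreducible, and the `L²`-closure of `V` is irreducible with `V` as its space of `K_∞`-finite
smooth vectors. Borel–Jacquet 1979, 4.4–4.6; Gelfand–Graev–Piatetski-Shapiro 1969, Ch. 3. [cite: BorelJacquet1979, 4.4–4.6] -/
def AutomorphicRepsGL.exists_isAssociatedL2 : Prop :=
  ∀ π : CuspidalAutomorphicRepData n K hcpt,
    (∀ φ ∈ π.1.W, ∀ z ∈ (AdelicGroupData.gl n K).center', ∀ g, φ (z * g) = φ g) →
    ∃ P : CuspidalAutomorphicRepGL n K μ, IsAssociatedL2 π P

variable (hcpt μ) in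
/-- **From `L²` to `(𝔤, K_∞) × G(𝔸_f)`-modules.** Every irreducible closed subspace `Π` of
`L²_cusp(GL_n(𝔸_K) ⧸ A_G GL_n(K), μ)` comes from a cuspidal automorphic representation datum:
its smooth `K_∞`-finite vectors are represented by cusp forms (`Z(𝔤)` acts by the infinitesimal
character of the irreducible unitary `Π_∞`), and they form an irreducible stable subspace
`V_Π = W`, `W' = ⊥`. Borel–Jacquet 1979, 4.6; Harish-Chandra 1953 (admissibility of irreducible
unitary representations). [cite: BorelJacquet1979, 4.6] -/
def AutomorphicRepsGL.exists_cuspidalRepData_of_L2 : Prop :=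
  ∀ P : CuspidalAutomorphicRepGL n K μ,
    ∃ π : CuspidalAutomorphicRepData n K hcpt, π.1.W' = ⊥ ∧ IsAssociatedL2 π P

variable (hcpt μ) in
/-- **The two notions of Satake parameter agree.** If `π = W / W'` is associated with
`Π ≤ L²_cusp`, then `α` is a Satake parameter of `π` at `v` (Hecke eigenvalues modulo `W'` of a
`K(𝔫)`-fixed form for `rightTranslation`) iff `α` is a Satake parameter of `Π` at `v` in G19's
sense (`HasSatakeParameterAt Π K(𝔫) v ϖ α`: Hecke eigenvalues of a `K(𝔫)`-fixed `L²`-vector for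
`rightRegular`) for some non-zero level `𝔫` prime to `v` and some uniformizer `ϖ`: `invQuot`
intertwines `rightRegular` with `rightTranslation` (`invQuot_smul`), so it commutes with the
double-coset operators `[K(𝔫) t_{v,i} K(𝔫)]`, and both sides are the character of the unramified
Hecke algebra on the spherical line of `π_v ≅ Π_v`. Borel–Jacquet 1979, 4.6; Bump §3.3. [cite: BorelJacquet1979, 4.6] -/
def hasSatakeParamAt_iff_L2 : Prop :=
  ∀ {π : CuspidalAutomorphicRepData n K hcpt} {P : CuspidalAutomorphicRepGL n K μ}
    (_h : IsAssociatedL2 π P) (v : HeightOneSpectrum (𝓞 K)) (α : Multiset ℂ),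
    π.1.HasSatakeParamAt v α ↔
      ∃ (𝔫 : Ideal (𝓞 K)) (ϖ : (v.adicCompletion K)ˣ), 𝔫 ≠ 0 ∧ ¬ v.asIdeal ∣ 𝔫 ∧
        HasSatakeParameterAt P.1 (principalCongruenceLevel n K 𝔫) v ϖ α

/-- Consequently `π` is unramified at `v` iff the associated `Π` is unramified at `v` in G19's
sense (`IsUnramifiedAt` of `GLnAdelicStructure`), given the named fact
`hasSatakeParamAt_iff_L2 hcpt μ` (hypothesis `hL2`). Borel–Jacquet 1979, 4.6. [cite: BorelJacquet1979, 4.6] -/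
theorem isUnramifiedAt_iff_L2 (hL2 : hasSatakeParamAt_iff_L2 hcpt μ)
    {π : CuspidalAutomorphicRepData n K hcpt} {P : CuspidalAutomorphicRepGL n K μ}
    (h : IsAssociatedL2 π P) (v : HeightOneSpectrum (𝓞 K)) :
    π.1.IsUnramifiedAt v ↔ Automorphic.IsUnramifiedAt P.1 v := by
  constructor
  · rintro ⟨α, hα⟩
    obtain ⟨𝔫, ϖ, h𝔫, hv, hP⟩ := (hL2 h v α).mp hα
    exact ⟨𝔫, h𝔫, hv, ϖ, α, hP⟩
  · rintro ⟨𝔫, h𝔫, hv, ϖ, α, hP⟩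
    exact ⟨α, (hL2 h v α).mpr ⟨𝔫, ϖ, h𝔫, hv, hP⟩⟩

end BridgeTheorems

/-! ## Harish-Chandra's finiteness theorem for `GL_n` -/

section Finiteness

variable {n K}

/-- **Harish-Chandra's finiteness theorem** for `GL_n` over `K` (Borel–Jacquet 1979, 4.3 (i);
Harish-Chandra, LNM 62, Thm. 1): the automorphic forms of a fixed level `U`, annihilated by the
ideal `ker θ` of `Z(𝔤)` (i.e. with `Z(𝔤)`-character `θ`, `HasZCharacter`) and of fixed
`K_∞`-types span a finite-dimensional space. The `K_∞`-types are fixed through a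
finite-dimensional right `K_∞`-stable space `M` of functions on `K_∞` required to contain every
slice `k ↦ φ (g k)` (for a finite set `F` of `K_∞`-types take `M` = the span of the matrix
coefficients of `F`; conversely the `K_∞`-types of such a `φ` are among those of `M`). [cite: BorelJacquet1979, 4.3 (i] -/
def harishChandra_finiteness_gl (hcpt : isCompact_glFiniteIntegralLevel n K) : Prop :=
  ∀ {U : Subgroup (GL (Fin n) (AdeleRing (𝓞 K) K))}
    (_hU : U ∈ finiteLevelsGL n K) (θ : centerU (archGroupGL n K) →ₐ[ℝ] ℂ)
    (M : Submodule ℂ (Kinf n K → ℂ)) [FiniteDimensional ℂ M]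
    (_hM : ∀ k₀ : Kinf n K, ∀ f ∈ M, (fun k ↦ f (k * k₀)) ∈ M),
    FiniteDimensional ℂ (Submodule.span ℂ
      {φ : (AdelicGroupData.gl n K).Adelic → ℂ | IsAutomorphicForm (AutomorphyDatum.gl n K hcpt) φ ∧
        IsRightInvariantUnder U φ ∧ HasZCharacter (AutomorphyDatum.gl n K hcpt).ofArch φ θ ∧
          ∀ g : (AdelicGroupData.gl n K).Adelic,
            (fun k : Kinf n K ↦ φ (g * (AutomorphyDatum.gl n K hcpt).ofK k)) ∈ M})

end Finiteness

end Literature.NumberTheory.Automorphic
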